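import Summits.ResolutionOfSingularities.ResolutionOfSingularities.Theorems.SectionAscentGenericLevel
import Summits.ResolutionOfSingularities.ResolutionOfSingularities.Theorems.FibrewiseClosedPoints.Negative.ExactSupport
import Mathlib.AlgebraicGeometry.AffineScheme

/-!
# `FibrewiseClosedPoints` — negative lemmas V: the exact-support repair of `Almost` is still met
by the finite normalisation junk whenever `Sing(Spec A)` is cut out by a conductor element

Support (negative) lemmas for crux `stmt-ResolutionOfSingularities-15960`
(`Summit.ResolutionOfSingularities.ResolutionOfSingularities.Theses.SectionAscent.FibrewiseClosedPoints`,
route SectionAscent: `∀ p prime, ∀ d, OneShot p d → Almost p (d+1) → OneShot p (d+1)`), filed by the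
standing crux disprover (cdisprove, generation 2, cycle 1, 2026-08-17). No `Prop` is defined and no
declaration concludes a route decl positively.

Context. As typed, the hypothesis `Almost p (d+1)` of the crux holds outright (landed
`RestatesTarget.almost_all`: the blowing up presenting the NORMALISATION has finite fibres, so the
clause "regular at every point not closed in its fibre" is vacuous), whence the crux is the route
target (`LoadBearing.fibrewiseClosedPoints_iff_oneShotAffine`). The repair suggested to the
planner (docstring of `Negative/RestatesTarget.lean`) is to make the centre EXACT in `Almost` as in
`OneShot`: `I ≤ 𝔭 ↔ A_𝔭 not regular`. `Negative/ExactSupport.lean` shows this kills the junk at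
every NORMAL variety (no invertible centre has zero set `Sing`, Krull). THIS file shows the repair
is NOT ENOUGH beyond normal varieties — kernel part:

* `exactAlmostBody_of_conductor_elem` — let `A` be a domain and `f ≠ 0` an element of the
  CONDUCTOR (`f · Ã ⊆ A`, `Ã` the integral closure of `A` in `Frac A`) whose zero set is exactly the
  non-regular locus (`f ∈ 𝔭 ↔ A_𝔭` not regular). Then `I := f²·Ã ⊆ A` satisfies the body of the
  REPAIRED `Almost` with exact support: `I ≤ 𝔭 ↔ A_𝔭 not regular`; every stalk of `Bl_I(Spec A)` is
  integrally closed; and NO point of `Bl_I(Spec A)` specialises properly inside its fibre (so the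
  fibre clause is again vacuous) — because `Bl_I(Spec A)` is the single chart
  `D₊(f²t) = Spec A[I/f²] = Spec Ã`, the finite normalisation (same one-chart mechanism as the landed
  `Theorems.exists_ideal_almost_of_normalization`, with `b = c = f`). Moreover
  (`not_isRegular_affineBlowup_of_conductor_elem`) if `Ã` has a non-regular local ring then this
  admissible `Bl_I(Spec A)` is NOT regular: the repaired hypothesis hands the prover a singular
  normal variety and nothing else.
* `exactAlmostBody_of_conductor_elem'` — the same packaged literally as the exact-support variant of
  the route's `let Almost` body (`I ≠ ⊥ ∧ exact support ∧ D(I) ⊆ Reg ∧ stalks ∧ fibre clause`).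

Paper part (existence of such `A` with `Ã` singular, every characteristic, every dimension `n ≥ 2`;
recorded for the planner, not formalised): PINCHING. Take any normal affine `Y = Spec B` of finite
type over `K` with `Sing Y ≠ ∅` (e.g. `B = K[s², st, t²][w₃, …, w_n]`), `0 ≠ f ∈ B` with
`Sing Y ⊆ V(f)` (J-2), a Noether normalisation `P = K[u₁, …, u_{n-1}] ⊆ B/fB` and
`C := K[u₁², u₂, …, u_{n-1}] ⊊ P`; put `A := {b ∈ B | b mod f ∈ C}`. Then `fB ⊆ A`, `B` is finite over
`A` (lift module generators of `B/fB` over `C`), `A` is of finite type (Artin–Tate), `Frac A = Frac B`,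
`Ã = B`; `NonNor(A) = Supp_A(B/A) = Supp_C((B/fB)/C) = V_A(fB)` since `(B/fB)/C ⊇ P/C ≅ C` is
faithful; off `V(f)` one has `A_𝔭 = B_𝔭` regular (as `Sing B ⊆ V(f)`), so `Sing A = V_A(f)` EXACTLY and
`f` is a conductor element as required, while `Ã = B` is singular. Consequence for the route: with
the exact-support `Almost`, the crux at `(p, d)` applied to such pinched `A` (of dimension `d`) must
still produce `Bl_{I'}(A)` regular, which is a resolution of the arbitrary normal `d`-fold `Y`
(it factors through `Y = Spec Ã`): the repaired crux still contains "strong one-shot resolution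
below `d` ⇒ resolution of every normal affine `d`-fold", i.e. the whole inductive step again
(cf. `Lines/birth.lean`, `weakSectionLift_iff`). A repair must constrain the witness model itself
(e.g. state the induction for NORMAL `A` only, where `ExactSupport` forbids finite witnesses at
singular points), not only its support.

## Sources
* O. Zariski, P. Samuel, *Commutative Algebra* II, Van Nostrand 1960, Ch. V §5 (conductor of the
  integral closure; finiteness). [ZariskiSamuel1960]
* Q. Liu, *Algebraic Geometry and Arithmetic Curves*, OUP 2002, Prop. 4.1.27 (finiteness of
  normalisation), Lemma 8.1.2 (blowing up an ideal that is invertible on a finite birational model).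
  [Liu2002]
* The Stacks Project, Tag 0804 (affine blowup algebras and charts `D₊(a t) = Spec R[I/a]`).
  [StacksProject]
-/

noncomputable section

set_option linter.dupNamespace false -- mandated namespace of this single-conjunct summit

open AlgebraicGeometry CategoryTheory Polynomial HomogeneousLocalization
open Literature.AlgebraicGeometry.Resolution
open Summit.ResolutionOfSingularities.ResolutionOfSingularities.Theses.SectionAscent
open Summit.ResolutionOfSingularities.ResolutionOfSingularities.Theorems

namespace Summit.ResolutionOfSingularities.ResolutionOfSingularities.Theorems.FibrewiseClosedPoints.Negative

universe u

open scoped nonZeroDivisors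

/-- **The exact-support `Almost` body from a conductor element cutting out `Sing`.** For a domain
`A` and `f ≠ 0` with `f·Ã ⊆ A` (`Ã` = integral closure of `A` in `Frac A`) and
`V(f) = Sing(Spec A)` exactly, the ideal `I = f²·Ã ∩ A = {x | x/f² ∈ Ã}` has: `f² ∈ I`; EXACT support
`I ≤ 𝔭 ↔ A_𝔭` not regular; all stalks of `Bl_I(Spec A)` integrally closed; no proper specialisation
inside a fibre of `Bl_I(Spec A) → Spec A`; and `Bl_I(Spec A)` is not regular as soon as some local
ring of `Ã` is not — for `Bl_I(Spec A) = D₊(f²t) ≅ Spec Ã`. [cite: StacksProject, Tag 0804;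
Liu2002, Prop. 4.1.27] -/
theorem exactAlmostBody_of_conductor_elem (A : Type u) [CommRing A] [IsDomain A] (f : A)
    (hf0 : f ≠ 0)
    (hcond : ∀ x : FractionRing A, x ∈ integralClosure A (FractionRing A) →
      ∃ a : A, algebraMap A (FractionRing A) a = algebraMap A (FractionRing A) f * x)
    (hsing : ∀ 𝔭 : PrimeSpectrum A, f ∈ 𝔭.asIdeal →
      ¬ IsRegularLocalRing (Localization.AtPrime 𝔭.asIdeal))
    (hreg : ∀ 𝔭 : PrimeSpectrum A, f ∉ 𝔭.asIdeal →
      IsRegularLocalRing (Localization.AtPrime 𝔭.asIdeal)) :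
    ∃ I : Ideal A, f * f ∈ I ∧
      (∀ 𝔭 : PrimeSpectrum A, I ≤ 𝔭.asIdeal ↔
        ¬ IsRegularLocalRing (Localization.AtPrime 𝔭.asIdeal)) ∧
      (∀ y : affineBlowup I, IsIntegrallyClosed ((affineBlowup I).presheaf.stalk y)) ∧
      (∀ y z : affineBlowup I, y ⤳ z →
        (affineBlowup.π I).base z = (affineBlowup.π I).base y → y = z) ∧
      ((∃ 𝔓 : PrimeSpectrum (integralClosure A (FractionRing A)),
          ¬ IsRegularLocalRing (Localization.AtPrime 𝔓.asIdeal)) →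
        ¬ Scheme.IsRegular (affineBlowup I)) := by
  classical
  -- notation: the fraction field and the normalisation
  let F := FractionRing A
  let Ã : Subalgebra A F := integralClosure A F
  have hinjF : Function.Injective (algebraMap A F) := IsFractionRing.injective A F
  have hc : ∀ x : F, x ∈ Ã → ∃ a : A, algebraMap A F a = algebraMap A F f * x := hcond
  -- the element `g = f f ≠ 0` and the ideal `I = {x | x / g ∈ Ã}`
  have hg0 : f * f ≠ 0 := mul_ne_zero hf0 hf0
  have hg0F : algebraMap A F (f * f) ≠ 0 := fun h => hg0 (hinjF (by rw [h, map_zero]))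
  let I : Ideal A :=
    ((Subalgebra.toSubmodule Ã).map (LinearMap.mulLeft A (algebraMap A F (f * f)))).comap
      (Algebra.linearMap A F)
  have hmemI : ∀ x : A, x ∈ I ↔ ∃ y ∈ Ã, algebraMap A F (f * f) * y = algebraMap A F x := by
    intro x
    simp only [I, Submodule.mem_comap, Algebra.linearMap_apply, Submodule.mem_map,
      Subalgebra.mem_toSubmodule, LinearMap.mulLeft_apply]
  have hgI : f * f ∈ I := (hmemI _).mpr ⟨1, Ã.one_mem, by rw [mul_one]⟩
  -- every element of `I` is a multiple of `f`
  have hIb : ∀ x ∈ I, ∃ a : A, x = f * a := by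
    intro x hx
    obtain ⟨y, hy, hxy⟩ := (hmemI x).mp hx
    obtain ⟨a, ha⟩ := hc y hy
    refine ⟨a, hinjF ?_⟩
    rw [← hxy, map_mul, map_mul, ha, mul_assoc]
  -- every `x ∈ I` has `x² ∈ g I`
  have hsq : ∀ x ∈ I, ∃ y ∈ I, x * x = (f * f) * y := by
    intro x hx
    obtain ⟨x', hx', hxx'⟩ := (hmemI x).mp hx
    obtain ⟨a, ha⟩ := hc (x' * x') (Ã.mul_mem hx' hx')
    refine ⟨f * a, (hmemI _).mpr ⟨x' * x', Ã.mul_mem hx' hx', ?_⟩, hinjF ?_⟩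
    · rw [map_mul (algebraMap A F) f a, ha, map_mul]
      ring
    · rw [map_mul, map_mul, map_mul (algebraMap A F) f a, ha, ← hxx', map_mul]
      ring
  -- the chart ring `(A[It])_{(gt)} ≅ A[I/g] ≅ Ã`
  have hunit : ∀ y : Submonoid.powers (f * f), IsUnit (Algebra.ofId A F y) := by
    rintro ⟨y, n, rfl⟩
    exact isUnit_iff_ne_zero.mpr (by
      rw [Algebra.ofId_apply, map_pow]
      exact pow_ne_zero _ hg0F)
  let ψ : Localization.Away (f * f) →ₐ[A] F :=
    IsLocalization.liftAlgHom (M := Submonoid.powers (f * f)) (f := Algebra.ofId A F) hunit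
  have hψinj : Function.Injective ψ := by
    rw [IsLocalization.coe_liftAlgHom, IsLocalization.lift_injective_iff]
    intro x y
    constructor
    · intro h
      exact congrArg _ (IsLocalization.injective (Localization.Away (f * f))
        (powers_le_nonZeroDivisors_of_noZeroDivisors hg0) h)
    · intro h
      exact congrArg _ (hinjF h)
  have hψg : ψ (IsLocalization.Away.invSelf (f * f)) = (algebraMap A F (f * f))⁻¹ := by
    have h1 : ψ (algebraMap A (Localization.Away (f * f)) (f * f)) *
        ψ (IsLocalization.Away.invSelf (f * f)) = 1 := by
      rw [← map_mul, IsLocalization.Away.mul_invSelf, map_one]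
    rw [AlgHom.commutes] at h1
    exact (eq_inv_of_mul_eq_one_right h1)
  have himage : ψ '' blowupAlgebraGens I (f * f) = (Ã : Set F) := by
    ext z
    constructor
    · rintro ⟨_, ⟨x, hx, rfl⟩, rfl⟩
      obtain ⟨y, hy, hxy⟩ := (hmemI x).mp hx
      rw [SetLike.mem_coe, map_mul ψ, AlgHom.commutes, hψg, ← hxy, mul_comm, ← mul_assoc,
        inv_mul_cancel₀ hg0F, one_mul]
      exact hy
    · intro hz
      obtain ⟨a, ha⟩ := hc z hz
      have hxI : f * a ∈ I := (hmemI _).mpr ⟨z, hz, by rw [map_mul, map_mul, ha]; ring⟩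
      refine ⟨_, ⟨f * a, hxI, rfl⟩, ?_⟩
      have hbc : algebraMap A F f * algebraMap A F f ≠ 0 := by rwa [← map_mul]
      rw [map_mul ψ, AlgHom.commutes, hψg, map_mul (algebraMap A F) f a, ha,
        map_mul (algebraMap A F) f f, ← mul_assoc (algebraMap A F f),
        mul_comm (algebraMap A F f * algebraMap A F f) z, mul_inv_cancel_right₀ hbc]
  have heq : (blowupAlgebra I (f * f)).map ψ = Ã := by
    rw [blowupAlgebra, AlgHom.map_adjoin, himage, Algebra.adjoin_eq]
  let e₂ : blowupAlgebra I (f * f) ≃ₐ[A] Ã :=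
    ((blowupAlgebra I (f * f)).equivMapOfInjective ψ hψinj).trans (Subalgebra.equivOfEq _ _ heq)
  let e : Away (reesGrading I) (reesT (f * f) hgI) ≃+* Ã :=
    (reesChartEquiv (f * f) hgI).trans e₂.toRingEquiv
  -- consequences: the chart ring is an integrally closed domain, integral over `A`
  haveI : IsDomain (Away (reesGrading I) (reesT (f * f) hgI)) := MulEquiv.isDomain Ã e.toMulEquiv
  haveI : IsIntegrallyClosed Ã := integralClosure.isIntegrallyClosedOfFiniteExtension F (L := F)
  haveI : IsIntegrallyClosed (Away (reesGrading I) (reesT (f * f) hgI)) :=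
    IsIntegrallyClosed.of_equiv e.symm
  have hint : (reesChartBase (I := I) (f * f) hgI).IsIntegral := by
    letI := (reesChartBase (I := I) (f * f) hgI).toAlgebra
    have hcomm : ∀ x : A, e (reesChartBase (I := I) (f * f) hgI x) = algebraMap A Ã x := by
      intro x
      change e₂ (reesChartEquiv (f * f) hgI (reesChartBase (f * f) hgI x)) = _
      rw [reesChartEquiv_reesChartBase, AlgEquiv.commutes]
    let eA : Away (reesGrading I) (reesT (f * f) hgI) ≃ₐ[A] Ã :=
      AlgEquiv.ofRingEquiv (f := e) (fun x => hcomm x)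
    haveI : Algebra.IsIntegral A (Away (reesGrading I) (reesT (f * f) hgI)) :=
      Algebra.IsIntegral.of_injective eA.toAlgHom eA.injective
    exact fun x => Algebra.IsIntegral.isIntegral x
  -- the one chart
  have htop := basicOpen_reesT_eq_top_of_sq (f * f) hgI hsq
  have hsurj := chartι_surjective_of_basicOpen_eq_top (f * f) hgI htop
  refine ⟨I, hgI, ?_, ?_, ?_, ?_⟩
  · -- exact support: `I ≤ 𝔭 ↔ f ∈ 𝔭 ↔ A_𝔭 singular`
    intro 𝔭
    constructor
    · intro hle
      have hff : f * f ∈ 𝔭.asIdeal := hle hgI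
      exact hsing 𝔭 ((𝔭.isPrime.mem_or_mem hff).elim id id)
    · intro hnreg x hx
      obtain ⟨a, rfl⟩ := hIb x hx
      have hf𝔭 : f ∈ 𝔭.asIdeal := by
        by_contra h
        exact hnreg (hreg 𝔭 h)
      exact 𝔭.asIdeal.mul_mem_right a hf𝔭
  · -- stalks are localisations of `Ã`
    intro y
    obtain ⟨q, rfl⟩ := hsurj y
    exact isIntegrallyClosed_stalk_chartι (f * f) hgI q
  · -- no proper specialisation inside a fibre (incomparability)
    intro y z hyz hπ
    obtain ⟨q, rfl⟩ := hsurj y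
    obtain ⟨q', rfl⟩ := hsurj z
    exact congrArg _ (eq_of_specializes_of_π_chartι_eq (f * f) hgI hint hyz hπ)
  · -- the junk: `Bl_I ≅ Spec Ã` is regular only if `Ã` is
    rintro ⟨𝔓, h𝔓⟩ hregBl
    apply h𝔓
    clear_value e
    haveI hq : (𝔓.asIdeal.comap e).IsPrime := Ideal.comap_isPrime e 𝔓.asIdeal
    have H : ((𝔓.asIdeal.comap e).primeCompl).map e.toMonoidHom = 𝔓.asIdeal.primeCompl := by
      ext y
      simp only [Submonoid.mem_map]
      constructor
      · rintro ⟨x, hx, rfl⟩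
        exact fun h => hx (Ideal.mem_comap.mpr h)
      · intro hy
        refine ⟨e.symm y, fun h => hy ?_, e.apply_symm_apply y⟩
        have h' : e (e.symm y) ∈ 𝔓.asIdeal := Ideal.mem_comap.mp h
        rwa [e.apply_symm_apply] at h'
    -- the chart local ring at `e⁻¹ 𝔓` is the stalk of `Bl_I` at the image point, hence regular
    let x : Spec (.of (Away (reesGrading I) (reesT (f * f) hgI))) := ⟨𝔓.asIdeal.comap e, hq⟩
    have hregq : IsRegularLocalRing (Localization.AtPrime (𝔓.asIdeal.comap e)) := by
      haveI := hregBl ((affineBlowup.chartι (I := I) (f * f) hgI).base x)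
      exact IsRegularLocalRing.of_ringEquiv
        (((asIso ((affineBlowup.chartι (I := I) (f * f) hgI).stalkMap x)).commRingCatIsoToRingEquiv).trans
          (Spec.stalkIso (CommRingCat.of (Away (reesGrading I) (reesT (f * f) hgI))) x).commRingCatIsoToRingEquiv)
    haveI := hregq
    exact IsRegularLocalRing.of_ringEquiv
      (IsLocalization.ringEquivOfRingEquiv (M := (𝔓.asIdeal.comap e).primeCompl)
        (T := 𝔓.asIdeal.primeCompl) (Localization.AtPrime (𝔓.asIdeal.comap e))
        (Localization.AtPrime 𝔓.asIdeal) e H)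

/-- **Not regular.** Under the hypotheses of `exactAlmostBody_of_conductor_elem`, if the
normalisation `Ã` has a non-regular local ring, the admissible exact-support `Almost` witness has a
NON-REGULAR blowing up (it is `Spec Ã`). [folklore] -/
theorem not_isRegular_affineBlowup_of_conductor_elem (A : Type u) [CommRing A] [IsDomain A]
    (f : A) (hf0 : f ≠ 0)
    (hcond : ∀ x : FractionRing A, x ∈ integralClosure A (FractionRing A) →
      ∃ a : A, algebraMap A (FractionRing A) a = algebraMap A (FractionRing A) f * x)
    (hsing : ∀ 𝔭 : PrimeSpectrum A, f ∈ 𝔭.asIdeal →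
      ¬ IsRegularLocalRing (Localization.AtPrime 𝔭.asIdeal))
    (hreg : ∀ 𝔭 : PrimeSpectrum A, f ∉ 𝔭.asIdeal →
      IsRegularLocalRing (Localization.AtPrime 𝔭.asIdeal))
    (hÃ : ∃ 𝔓 : PrimeSpectrum (integralClosure A (FractionRing A)),
      ¬ IsRegularLocalRing (Localization.AtPrime 𝔓.asIdeal)) :
    ∃ I : Ideal A, I ≠ ⊥ ∧
      (∀ 𝔭 : PrimeSpectrum A, I ≤ 𝔭.asIdeal ↔
        ¬ IsRegularLocalRing (Localization.AtPrime 𝔭.asIdeal)) ∧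
      (∀ y : affineBlowup I, IsIntegrallyClosed ((affineBlowup I).presheaf.stalk y)) ∧
      (∀ y : affineBlowup I, (∃ z : affineBlowup I, z ≠ y ∧ y ⤳ z ∧
        (affineBlowup.π I).base z = (affineBlowup.π I).base y) →
          IsRegularLocalRing ((affineBlowup I).presheaf.stalk y)) ∧
      ¬ Scheme.IsRegular (affineBlowup I) := by
  obtain ⟨I, hgI, hexact, hstalk, hfib, hjunk⟩ :=
    exactAlmostBody_of_conductor_elem A f hf0 hcond hsing hreg
  refine ⟨I, ?_, hexact, hstalk, ?_, hjunk hÃ⟩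
  · intro h
    rw [h, Ideal.mem_bot] at hgI
    exact mul_ne_zero hf0 hf0 hgI
  · rintro y ⟨z, hzy, hyz, hπ⟩
    exact absurd (hfib y z hyz hπ).symm hzy

/-- **The exact-support `Almost` body, literally.** Under the hypotheses of
`exactAlmostBody_of_conductor_elem` the exact-support variant of the route's `let Almost` body
holds at `A` — `I ≠ ⊥`, EXACT support, `D(I) ⊆ Reg` (implied by exactness), integrally closed
stalks, and the fibre clause (vacuously) — with NO resolution content: the witness is the finite
normalisation. So "make the centre exact" does not repair `Almost` at such `A`. [folklore] -/
theorem exactAlmostBody_of_conductor_elem' (A : Type u) [CommRing A] [IsDomain A] (f : A)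
    (hf0 : f ≠ 0)
    (hcond : ∀ x : FractionRing A, x ∈ integralClosure A (FractionRing A) →
      ∃ a : A, algebraMap A (FractionRing A) a = algebraMap A (FractionRing A) f * x)
    (hsing : ∀ 𝔭 : PrimeSpectrum A, f ∈ 𝔭.asIdeal →
      ¬ IsRegularLocalRing (Localization.AtPrime 𝔭.asIdeal))
    (hreg : ∀ 𝔭 : PrimeSpectrum A, f ∉ 𝔭.asIdeal →
      IsRegularLocalRing (Localization.AtPrime 𝔭.asIdeal)) :
    ∃ I : Ideal A, I ≠ ⊥ ∧
      (∀ 𝔭 : PrimeSpectrum A, I ≤ 𝔭.asIdeal ↔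
        ¬ IsRegularLocalRing (Localization.AtPrime 𝔭.asIdeal)) ∧
      (∀ 𝔭 : PrimeSpectrum A, ¬ I ≤ 𝔭.asIdeal →
        IsRegularLocalRing (Localization.AtPrime 𝔭.asIdeal)) ∧
      (∀ y : affineBlowup I, IsIntegrallyClosed ((affineBlowup I).presheaf.stalk y)) ∧
      ∀ y : affineBlowup I, (∃ z : affineBlowup I, z ≠ y ∧ y ⤳ z ∧
        (affineBlowup.π I).base z = (affineBlowup.π I).base y) →
          IsRegularLocalRing ((affineBlowup I).presheaf.stalk y) := by
  obtain ⟨I, hgI, hexact, hstalk, hfib, -⟩ :=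
    exactAlmostBody_of_conductor_elem A f hf0 hcond hsing hreg
  refine ⟨I, ?_, hexact, ?_, hstalk, ?_⟩
  · intro h
    rw [h, Ideal.mem_bot] at hgI
    exact mul_ne_zero hf0 hf0 hgI
  · intro 𝔭 h𝔭
    by_contra hn
    exact h𝔭 ((hexact 𝔭).mpr hn)
  · rintro y ⟨z, hzy, hyz, hπ⟩
    exact absurd (hfib y z hyz hπ).symm hzy

end Summit.ResolutionOfSingularities.ResolutionOfSingularities.Theorems.FibrewiseClosedPoints.Negative

end
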